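import Literature.MathematicalPhysics.StatisticalMechanics.LocalMatchingCompactness
import Summits.AtomisticToContinuum.Crystallization.Theorems.SlackRigidity.Negative.WitnessBasics
import HarnessLib

/-!
# Line `c-layer-witness-strictness` (crux `SlackRigidity`, stmt-AtomisticToContinuum-11960): the local limit

Stub `stub_localLimit` of the line skeleton: a sequence of `1/3`-separated rooted point sets
`S_k ∋ 0` of `ℝ³`, none of them root-matched to the periodic configuration `P` at scale
`(R, ε)`, whose local `(F, U)`-slack vanishes, has a local limit `Y` which is a ZERO-SLACK set —
`1/3`-separated, `0 ∈ Y`, every recentred `ρ'`-star `((· - y) '' Y) ∩ B̄(0, ρ')` is `F`-tight,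
every pair distance is a zero of `U` — and which is not root-matched at `(R + 1, ε / 2)`.

Proof (deterministic, no measure theory).  The tree's sequential compactness of uniformly
discrete point sets in the local matching topology
(`exists_subseq_forall_eventually_ballMatch`, `δ = 1/3`) gives a subsequence `φ` and a
`1/3`-separated `Y` with `BallMatch η R' 0 (S (φ k)) Y` eventually in `k`, for all `R'` and all
`η > 0`.  Then:

* `0 ∈ Y`: the partners in `Y` of the root `0 ∈ S (φ k)` have arbitrarily small norm, and two
  of them closer than `1/3` coincide (`zero_mem_of_ballMatch`);
* recentring: if `s ∈ S (φ k)` is within `η / 2` of `y ∈ Y` and `k` is large, the recentred sets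
  `S (φ k) - s` and `Y - y` are `η`-matched on any fixed ball (`eventually_ballMatch_recentre`);
* `F`-tightness of the stars of `Y`: uniform continuity of `F` in the matching topology plus
  `F (star (s_k)) → 0` along partners `s_k → y` and `F ≥ 0` (`star_tight`);
* `U (dist y y') = 0` for `y ≠ y'`: the partner distances tend to `dist y y' ≥ 1/3 > 0`, where
  `U` is continuous, and `0 ≤ U (dist s_k s'_k) → 0` (`pair_tight`);
* no root-matching at `(R + 1, ε / 2)`: composing such a matching with a
  `min (ε/2) 1`-matching of `S (φ k)` and `Y` on the ball of radius `R + 1 + ε` would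
  root-match `S (φ k)` at `(R, ε)` (`not_matched`).

All `[folklore]` (Baake–Grimm 2013, Remark 5.6, for the local rubber topology).
-/

noncomputable section

namespace Summit.AtomisticToContinuum.Crystallization.Theorems.CLayerWitnessLocalLimit

open scoped Topology
open Filter Set Metric
open Literature.MathematicalPhysics.StatisticalMechanics
open Summit.AtomisticToContinuum.Crystallization.Theorems.SlackRigidityNegative (E3)

/-! ## Elementary metric facts -/

/-- `‖s‖ ≤ dist s y + ‖y‖` (triangle inequality through `y`). [folklore] -/
theorem norm_le_dist_add_norm (s y : E3) : ‖s‖ ≤ dist s y + ‖y‖ := by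
  have h := dist_triangle s y 0
  rwa [dist_zero_right, dist_zero_right] at h

/-- Translation preserves `1/3`-separation. [folklore] -/
theorem sep_image_sub {X : Set E3}
    (hX : ∀ p ∈ X, ∀ q ∈ X, p ≠ q → (1 / 3 : ℝ) ≤ dist p q) (c : E3) :
    ∀ p ∈ (fun z => z - c) '' X, ∀ q ∈ (fun z => z - c) '' X, p ≠ q →
      (1 / 3 : ℝ) ≤ dist p q := by
  rintro _ ⟨p, hp, rfl⟩ _ ⟨q, hq, rfl⟩ hne
  have hpq : p ≠ q := fun h => hne (by rw [h])
  have h := hX p hp q hq hpq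
  rwa [← dist_sub_right p q c] at h

/-- The recentred set contains the origin. [folklore] -/
theorem zero_mem_image_sub {X : Set E3} {c : E3} (hc : c ∈ X) :
    (0 : E3) ∈ (fun z => z - c) '' X :=
  ⟨c, hc, sub_self c⟩

/-- Distance of two differences: `dist (a - s) (y' - y) ≤ dist a y' + dist s y`. [folklore] -/
theorem dist_sub_sub_le_dist_add_dist (a s y' y : E3) :
    dist (a - s) (y' - y) ≤ dist a y' + dist s y := by
  calc dist (a - s) (y' - y) = ‖(a - y') - (s - y)‖ := by
        rw [dist_eq_norm]; congr 1; abel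
    _ ≤ ‖a - y'‖ + ‖s - y‖ := norm_sub_le _ _
    _ = dist a y' + dist s y := by rw [dist_eq_norm, dist_eq_norm]

/-! ## Consequences of local matching convergence `BallMatch η R' 0 (T k) Y` (eventually) -/

/-- The root survives in the limit: if every `T k` contains `0` and `Y` is `1/3`-separated,
then `0 ∈ Y`. [folklore] -/
theorem zero_mem_of_ballMatch {T : ℕ → Set E3} {Y : Set E3}
    (hYsep : ∀ p ∈ Y, ∀ q ∈ Y, p ≠ q → (1 / 3 : ℝ) ≤ dist p q)
    (h0 : ∀ k, (0 : E3) ∈ T k)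
    (hlim : ∀ R' η : ℝ, 0 < η → ∀ᶠ k in atTop, BallMatch η R' 0 (T k) Y) :
    (0 : E3) ∈ Y := by
  have hnear : ∀ η : ℝ, 0 < η → ∃ y ∈ Y, ‖y‖ ≤ η := by
    intro η hη
    obtain ⟨k, hk⟩ := (hlim 0 η hη).exists
    obtain ⟨y, hy, hy0⟩ := hk.2 0 (h0 k) (by rw [dist_self])
    exact ⟨y, hy, by rwa [dist_zero_left] at hy0⟩
  obtain ⟨y₁, hy₁, hy₁n⟩ := hnear (1 / 7) (by norm_num)
  by_contra h0Y
  have hy₁0 : y₁ ≠ 0 := fun h => h0Y (h ▸ hy₁)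
  have hpos : 0 < ‖y₁‖ := norm_pos_iff.2 hy₁0
  obtain ⟨y₂, hy₂, hy₂n⟩ := hnear (‖y₁‖ / 2) (half_pos hpos)
  have hne : y₂ ≠ y₁ := by
    intro h
    rw [h] at hy₂n
    linarith
  have h := hYsep y₂ hy₂ y₁ hy₁ hne
  have h' : dist y₂ y₁ ≤ ‖y₂‖ + ‖y₁‖ := dist_le_norm_add_norm _ _
  linarith

/-- Every point of the limit has partners: eventually `T k` has a point within `η` of `y ∈ Y`.
[folklore] -/
theorem eventually_exists_partner {T : ℕ → Set E3} {Y : Set E3}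
    (hlim : ∀ R' η : ℝ, 0 < η → ∀ᶠ k in atTop, BallMatch η R' 0 (T k) Y)
    {y : E3} (hy : y ∈ Y) {η : ℝ} (hη : 0 < η) :
    ∀ᶠ k in atTop, ∃ s ∈ T k, dist s y ≤ η := by
  filter_upwards [hlim ‖y‖ η hη] with k hk
  exact hk.1 y hy (dist_zero_right y).le

/-- **Recentring.** Eventually in `k`, for every `s ∈ T k` within `η / 2` of a point `y`, the
recentred sets `T k - s` and `Y - y` are `η`-matched on the ball of radius `ρ` about `0`.
[folklore] -/
theorem eventually_ballMatch_recentre {T : ℕ → Set E3} {Y : Set E3}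
    (hlim : ∀ R' η : ℝ, 0 < η → ∀ᶠ k in atTop, BallMatch η R' 0 (T k) Y)
    (y : E3) (ρ : ℝ) {η : ℝ} (hη : 0 < η) :
    ∀ᶠ k in atTop, ∀ s ∈ T k, dist s y ≤ η / 2 →
      BallMatch η ρ 0 ((fun z => z - s) '' T k) ((fun z => z - y) '' Y) := by
  filter_upwards [hlim (‖y‖ + ρ + η) (η / 2) (half_pos hη)] with k hk s hs hsy
  have hsy' : ‖s - y‖ ≤ η / 2 := by rwa [← dist_eq_norm]
  refine ⟨?_, ?_⟩
  · rintro t ⟨y', hy', rfl⟩ ht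
    have ht' : ‖y' - y‖ ≤ ρ := by rwa [dist_zero_right] at ht
    have hy'R : dist y' 0 ≤ ‖y‖ + ρ + η := by
      rw [dist_zero_right]
      calc ‖y'‖ = ‖(y' - y) + y‖ := by rw [sub_add_cancel]
        _ ≤ ‖y' - y‖ + ‖y‖ := norm_add_le _ _
        _ ≤ ‖y‖ + ρ + η := by linarith
    obtain ⟨a, ha, hay'⟩ := hk.1 y' hy' hy'R
    exact ⟨a - s, ⟨a, ha, rfl⟩,
      (dist_sub_sub_le_dist_add_dist a s y' y).trans (by linarith)⟩
  · rintro u ⟨a, ha, rfl⟩ hu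
    have hu' : ‖a - s‖ ≤ ρ := by rwa [dist_zero_right] at hu
    have haR : dist a 0 ≤ ‖y‖ + ρ + η := by
      rw [dist_zero_right]
      calc ‖a‖ = ‖(a - s) + (s - y) + y‖ := by congr 1; abel
        _ ≤ ‖a - s‖ + ‖s - y‖ + ‖y‖ := norm_add₃_le
        _ ≤ ‖y‖ + ρ + η := by linarith
    obtain ⟨y', hy', hay'⟩ := hk.2 a ha haR
    exact ⟨y' - y, ⟨y', hy', rfl⟩,
      (dist_sub_sub_le_dist_add_dist a s y' y).trans (by linarith)⟩

/-- **`F`-tightness of the stars of the limit.** If `F ≥ 0` is uniformly continuous in the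
matching topology (at radius `ρ' + 1`) on `1/3`-separated rooted sets and the `F`-slack of the
recentred `ρ'`-stars of `T k` vanishes locally uniformly, then every recentred `ρ'`-star of the
limit `Y` is `F`-tight. [folklore] -/
theorem star_tight {T : ℕ → Set E3} {Y : Set E3} {ρ' : ℝ} {F : Set E3 → ℝ}
    (hF0 : ∀ T : Set E3, 0 ≤ F T)
    (hFc : ∀ ε' : ℝ, 0 < ε' → ∃ η : ℝ, 0 < η ∧ ∀ S' T : Set E3,
        (∀ p ∈ S', ∀ q ∈ S', p ≠ q → (1 / 3 : ℝ) ≤ dist p q) →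
        (∀ p ∈ T, ∀ q ∈ T, p ≠ q → (1 / 3 : ℝ) ≤ dist p q) →
        (0 : E3) ∈ S' → (0 : E3) ∈ T → BallMatch η (ρ' + 1) 0 S' T →
        |F (S' ∩ Metric.closedBall 0 ρ') - F (T ∩ Metric.closedBall 0 ρ')| ≤ ε')
    (hsep : ∀ k, ∀ p ∈ T k, ∀ q ∈ T k, p ≠ q → (1 / 3 : ℝ) ≤ dist p q)
    (hYsep : ∀ p ∈ Y, ∀ q ∈ Y, p ≠ q → (1 / 3 : ℝ) ≤ dist p q)
    (hlim : ∀ R' η : ℝ, 0 < η → ∀ᶠ k in atTop, BallMatch η R' 0 (T k) Y)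
    (hslackF : ∀ L η : ℝ, 0 < η → ∀ᶠ k in atTop, ∀ s ∈ T k, ‖s‖ ≤ L →
        F (((fun z => z - s) '' T k) ∩ Metric.closedBall 0 ρ') ≤ η)
    {y : E3} (hy : y ∈ Y) :
    F (((fun z => z - y) '' Y) ∩ Metric.closedBall 0 ρ') = 0 := by
  refine le_antisymm (le_of_forall_pos_le_add fun ε' hε' => ?_) (hF0 _)
  obtain ⟨η₀, hη₀, hcont⟩ := hFc (ε' / 2) (half_pos hε')
  have h1 := eventually_ballMatch_recentre hlim y (ρ' + 1) hη₀
  have h2 := eventually_exists_partner hlim hy (lt_min (half_pos hη₀) one_pos)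
  have h3 := hslackF (‖y‖ + 1) (ε' / 2) (half_pos hε')
  obtain ⟨k, hk1, ⟨s, hs, hsy⟩, hk3⟩ := (h1.and (h2.and h3)).exists
  have hsy1 : dist s y ≤ η₀ / 2 := hsy.trans (min_le_left _ _)
  have hsy2 : dist s y ≤ 1 := hsy.trans (min_le_right _ _)
  have hsL : ‖s‖ ≤ ‖y‖ + 1 := by
    have h := norm_le_dist_add_norm s y
    linarith
  have hc := hcont _ _ (sep_image_sub (hsep k) s) (sep_image_sub hYsep y)
    (zero_mem_image_sub hs) (zero_mem_image_sub hy) (hk1 s hs hsy1)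
  have hFs := hk3 s hs hsL
  rw [abs_le] at hc
  linarith [hc.1, hc.2]

/-- **`U`-tightness of the pair distances of the limit.** If `U ≥ 0` is continuous on `(0, ∞)`
and the `U`-slack of the pairs of `T k` vanishes locally uniformly, then `U (dist y y') = 0` for
all distinct `y, y'` in the (`1/3`-separated) limit `Y`. [folklore] -/
theorem pair_tight {T : ℕ → Set E3} {Y : Set E3} {U : ℝ → ℝ}
    (hU0 : ∀ r : ℝ, 0 < r → 0 ≤ U r) (hUc : ContinuousOn U (Set.Ioi 0))
    (hYsep : ∀ p ∈ Y, ∀ q ∈ Y, p ≠ q → (1 / 3 : ℝ) ≤ dist p q)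
    (hlim : ∀ R' η : ℝ, 0 < η → ∀ᶠ k in atTop, BallMatch η R' 0 (T k) Y)
    (hslackU : ∀ L η : ℝ, 0 < η → ∀ᶠ k in atTop, ∀ s ∈ T k, ‖s‖ ≤ L →
        ∀ s' ∈ T k, s' ≠ s → ‖s'‖ ≤ L → U (dist s s') ≤ η)
    {y y' : E3} (hy : y ∈ Y) (hy' : y' ∈ Y) (hne : y ≠ y') :
    U (dist y y') = 0 := by
  have hd3 : (1 / 3 : ℝ) ≤ dist y y' := hYsep y hy y' hy' hne
  have hd0 : 0 < dist y y' := by linarith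
  refine le_antisymm (le_of_forall_pos_le_add fun κ hκ => ?_) (hU0 _ hd0)
  have hca : ContinuousAt U (dist y y') := hUc.continuousAt (Ioi_mem_nhds hd0)
  obtain ⟨θ, hθ, hθU⟩ := Metric.continuousAt_iff.1 hca (κ / 2) (half_pos hκ)
  have hτ0 : 0 < min (θ / 3) (1 / 9) := lt_min (by linarith) (by norm_num)
  have hτθ : min (θ / 3) (1 / 9) ≤ θ / 3 := min_le_left _ _
  have hτ9 : min (θ / 3) (1 / 9) ≤ 1 / 9 := min_le_right _ _
  have h1 := eventually_exists_partner hlim hy hτ0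
  have h2 := eventually_exists_partner hlim hy' hτ0
  have h3 := hslackU (‖y‖ + ‖y'‖ + 1) (κ / 2) (half_pos hκ)
  obtain ⟨k, ⟨s, hs, hsy⟩, ⟨s', hs', hs'y'⟩, hk3⟩ := (h1.and (h2.and h3)).exists
  have hss' : s' ≠ s := by
    intro h
    rw [h] at hs'y'
    have : dist y y' ≤ dist s y + dist s y' := by
      rw [dist_comm s y]
      exact dist_triangle y s y'
    linarith
  have hsL : ‖s‖ ≤ ‖y‖ + ‖y'‖ + 1 := by
    have h := norm_le_dist_add_norm s y
    linarith [norm_nonneg y']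
  have hs'L : ‖s'‖ ≤ ‖y‖ + ‖y'‖ + 1 := by
    have h := norm_le_dist_add_norm s' y'
    linarith [norm_nonneg y]
  have hUss' := hk3 s hs hsL s' hs' hss' hs'L
  have hclose : dist (dist s s') (dist y y') < θ :=
    calc dist (dist s s') (dist y y') ≤ dist s y + dist s' y' := dist_dist_dist_le _ _ _ _
      _ < θ := by linarith
  have hU := hθU hclose
  rw [Real.dist_eq, abs_lt] at hU
  linarith [hU.1, hU.2]

/-- **No root-matching survives to the limit at the weaker scale.** If no `T k` is root-matched
to `P` at `(R, ε)`, then the limit `Y` is not root-matched to `P` at `(R + 1, ε / 2)`.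
[folklore] -/
theorem not_matched {T : ℕ → Set E3} {Y : Set E3} {P : PeriodicConfiguration 3} {R ε : ℝ}
    (hε : 0 < ε)
    (hbad : ∀ k, ¬ ∃ A : E3 →ₗᵢ[ℝ] E3,
        (∀ p ∈ P.points, ‖p‖ ≤ R → ∃ q ∈ T k, dist q (A p) ≤ ε) ∧
        (∀ q ∈ T k, ‖q‖ ≤ R → ∃ p ∈ P.points, dist q (A p) ≤ ε))
    (hlim : ∀ R' η : ℝ, 0 < η → ∀ᶠ k in atTop, BallMatch η R' 0 (T k) Y) :
    ¬ ∃ A : E3 →ₗᵢ[ℝ] E3,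
      (∀ p ∈ P.points, ‖p‖ ≤ R + 1 → ∃ q ∈ Y, dist q (A p) ≤ ε / 2) ∧
      (∀ q ∈ Y, ‖q‖ ≤ R + 1 → ∃ p ∈ P.points, dist q (A p) ≤ ε / 2) := by
  rintro ⟨A, hA1, hA2⟩
  have hη0 : 0 < min (ε / 2) 1 := lt_min (half_pos hε) one_pos
  have hηε : min (ε / 2) 1 ≤ ε / 2 := min_le_left _ _
  have hη1 : min (ε / 2) 1 ≤ 1 := min_le_right _ _
  obtain ⟨k, hk⟩ := (hlim (R + 1 + ε) _ hη0).exists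
  refine hbad k ⟨A, fun p hp hpR => ?_, fun a ha haR => ?_⟩
  · obtain ⟨q, hq, hqAp⟩ := hA1 p hp (by linarith)
    have hqR : dist q 0 ≤ R + 1 + ε := by
      calc dist q 0 ≤ dist q (A p) + dist (A p) 0 := dist_triangle _ _ _
        _ = dist q (A p) + ‖p‖ := by rw [dist_zero_right, LinearIsometry.norm_map]
        _ ≤ R + 1 + ε := by linarith
    obtain ⟨a, ha, haq⟩ := hk.1 q hq hqR
    refine ⟨a, ha, ?_⟩
    calc dist a (A p) ≤ dist a q + dist q (A p) := dist_triangle _ _ _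
      _ ≤ ε := by linarith
  · have haR' : dist a 0 ≤ R + 1 + ε := by
      rw [dist_zero_right]
      linarith
    obtain ⟨q, hq, haq⟩ := hk.2 a ha haR'
    have hqR : ‖q‖ ≤ R + 1 := by
      have h := norm_le_dist_add_norm q a
      rw [dist_comm] at h
      linarith
    obtain ⟨p, hp, hqAp⟩ := hA2 q hq hqR
    refine ⟨p, hp, ?_⟩
    calc dist a (A p) ≤ dist a q + dist q (A p) := dist_triangle _ _ _
      _ ≤ ε := by linarith

/-! ## The stub -/

/-- **Stub `stub_localLimit` of line `c-layer-witness-strictness` (crux `SlackRigidity`) — the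
local limit is zero-slack and unmatched.**  A sequence of `1/3`-separated rooted sets
`S_k ∋ 0`, none root-matched at `(R, ε)`, with vanishing local `(F,U)`-slack, has — for `U ≥ 0`
continuous on `(0,∞)`, `F ≥ 0` uniformly continuous in the local matching topology on separated
rooted sets — a local limit `Y` that is a ZERO-SLACK SET: `1/3`-separated, `0 ∈ Y`, every
recentred `ρ'`-star `F`-tight, every pair distance a zero of `U`; and `Y` is not root-matched
at `(R + 1, ε/2)`.  Proof: sequential compactness in the local matching topology
(`exists_subseq_forall_eventually_ballMatch`, `δ = 1/3`) and transport along the matching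
(`zero_mem_of_ballMatch`, `star_tight`, `pair_tight`, `not_matched`). [folklore] -/
theorem stub_localLimit :
    ∀ (P : PeriodicConfiguration 3) (ρ' R ε : ℝ) (U : ℝ → ℝ) (F : Set E3 → ℝ) (S : ℕ → Set E3),
      0 < ε →
      (∀ r : ℝ, 0 < r → 0 ≤ U r) → ContinuousOn U (Set.Ioi 0) → (∀ T : Set E3, 0 ≤ F T) →
      (∀ ε' : ℝ, 0 < ε' → ∃ η : ℝ, 0 < η ∧ ∀ S' T : Set E3,
        (∀ p ∈ S', ∀ q ∈ S', p ≠ q → (1 / 3 : ℝ) ≤ dist p q) →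
        (∀ p ∈ T, ∀ q ∈ T, p ≠ q → (1 / 3 : ℝ) ≤ dist p q) →
        (0 : E3) ∈ S' → (0 : E3) ∈ T → BallMatch η (ρ' + 1) 0 S' T →
        |F (S' ∩ Metric.closedBall 0 ρ') - F (T ∩ Metric.closedBall 0 ρ')| ≤ ε') →
      (∀ k, ∀ p ∈ S k, ∀ q ∈ S k, p ≠ q → (1 / 3 : ℝ) ≤ dist p q) →
      (∀ k, (0 : E3) ∈ S k) →
      (∀ k, ¬ ∃ A : E3 →ₗᵢ[ℝ] E3,
        (∀ p ∈ P.points, ‖p‖ ≤ R → ∃ q ∈ S k, dist q (A p) ≤ ε) ∧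
        (∀ q ∈ S k, ‖q‖ ≤ R → ∃ p ∈ P.points, dist q (A p) ≤ ε)) →
      (∀ L η : ℝ, 0 < η → ∀ᶠ k in Filter.atTop, ∀ s ∈ S k, ‖s‖ ≤ L →
        F (((fun z => z - s) '' S k) ∩ Metric.closedBall 0 ρ') ≤ η ∧
        ∀ s' ∈ S k, s' ≠ s → ‖s'‖ ≤ L → U (dist s s') ≤ η) →
      ∃ Y : Set E3,
        (∀ p ∈ Y, ∀ q ∈ Y, p ≠ q → (1 / 3 : ℝ) ≤ dist p q) ∧ (0 : E3) ∈ Y ∧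
        (∀ y ∈ Y, F (((fun z => z - y) '' Y) ∩ Metric.closedBall 0 ρ') = 0) ∧
        (∀ y ∈ Y, ∀ y' ∈ Y, y ≠ y' → U (dist y y') = 0) ∧
        ¬ ∃ A : E3 →ₗᵢ[ℝ] E3,
          (∀ p ∈ P.points, ‖p‖ ≤ R + 1 → ∃ q ∈ Y, dist q (A p) ≤ ε / 2) ∧
          (∀ q ∈ Y, ‖q‖ ≤ R + 1 → ∃ p ∈ P.points, dist q (A p) ≤ ε / 2) := by
  intro P ρ' R ε U F S hε hU0 hUc hF0 hFc hsep h0 hbad hslack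
  obtain ⟨φ, Y, hφ, hYsep, hlim⟩ :=
    exists_subseq_forall_eventually_ballMatch (by norm_num : (0 : ℝ) < 1 / 3) S hsep
  -- transport the hypotheses along the subsequence `T k := S (φ k)`
  have hsepφ : ∀ k, ∀ p ∈ S (φ k), ∀ q ∈ S (φ k), p ≠ q → (1 / 3 : ℝ) ≤ dist p q :=
    fun k => hsep (φ k)
  have h0φ : ∀ k, (0 : E3) ∈ S (φ k) := fun k => h0 (φ k)
  have hbadφ : ∀ k, ¬ ∃ A : E3 →ₗᵢ[ℝ] E3,
      (∀ p ∈ P.points, ‖p‖ ≤ R → ∃ q ∈ S (φ k), dist q (A p) ≤ ε) ∧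
      (∀ q ∈ S (φ k), ‖q‖ ≤ R → ∃ p ∈ P.points, dist q (A p) ≤ ε) :=
    fun k => hbad (φ k)
  have hslackφ : ∀ L η : ℝ, 0 < η → ∀ᶠ k in atTop, ∀ s ∈ S (φ k), ‖s‖ ≤ L →
      F (((fun z => z - s) '' S (φ k)) ∩ Metric.closedBall 0 ρ') ≤ η ∧
      ∀ s' ∈ S (φ k), s' ≠ s → ‖s'‖ ≤ L → U (dist s s') ≤ η :=
    fun L η hη => hφ.tendsto_atTop.eventually (hslack L η hη)
  have hlim' : ∀ R' η : ℝ, 0 < η → ∀ᶠ k in atTop,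
      BallMatch η R' 0 ((fun k => S (φ k)) k) Y := hlim
  refine ⟨Y, hYsep, zero_mem_of_ballMatch hYsep h0φ hlim', fun y hy => ?_,
    fun y hy y' hy' hne => ?_, not_matched (T := fun k => S (φ k)) hε hbadφ hlim'⟩
  · exact star_tight (T := fun k => S (φ k)) hF0 hFc hsepφ hYsep hlim'
      (fun L η hη => (hslackφ L η hη).mono fun k hk s hs hsL => (hk s hs hsL).1) hy
  · exact pair_tight (T := fun k => S (φ k)) hU0 hUc hYsep hlim'
      (fun L η hη => (hslackφ L η hη).mono fun k hk s hs hsL => (hk s hs hsL).2) hy hy' hne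

end Summit.AtomisticToContinuum.Crystallization.Theorems.CLayerWitnessLocalLimit

end
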